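import Mathlib
import HarnessLib
import Summits.Parity.BatemanHorn.Theses.OneSidedDegreeLadder

/-!
# Route `OneSidedDegreeLadder`, glue item `LowerNonlinearGlue` (stmt-Parity-26568)

The glue of the split (generation 1) of the lower leaf `LowerNonlinear` (stmt-Parity-25177) of the
decomp-parity BH-side node of record: `ChenQuad → ChenRest → ParityLift → LowerNonlinear`.
On the cell {one irreducible quadratic} the excess-1 almost-prime lower bound is `ChenQuad` (after
rewriting the one-member system as `![q]`), on every other nonlinear cell it is `ChenRest`;
`ParityLift` lifts it cell-wise to the prime count `polyPrimeCount`.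

Proof = the READY-TO-LAND text prepared by the decomp-parity lens-1 seat
(`HOME/decomp-parity-lens-1/g2/LowerNonlinearGlue.lean`; the same argument is `closes` in the cell file
`AlmostPrimeExcessLadder.lean`, kernel-checked with standard axioms), landed by a prover-class hand.
-/

open Filter Finset Polynomial
open Literature.NumberTheory.Sieve

namespace Summit.Parity.BatemanHorn.Theses.OneSidedDegreeLadder

/-- A one-member family is the vector `![f 0]`. -/
theorem LowerNonlinearGlue.vec_single_eq {α : Type*} (f : Fin 1 → α) : f = ![f 0] := by
  ext i
  rw [Fin.fin_one_eq_zero i]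
  rfl

/-- The excess-1 almost-prime count of a one-member system `![q]` is the `P₂` count of `q`. -/
theorem LowerNonlinearGlue.count_single (q : ℤ[X]) (x : ℕ) :
    ((Finset.range (x + 1)).filter fun n : ℕ =>
        (∀ i : Fin 1, 1 < (![q] i).eval (n : ℤ)) ∧
          ∑ i : Fin 1, ArithmeticFunction.cardFactors (((![q] i).eval (n : ℤ)).toNat) ≤ 1 + 1).card =
      ((Finset.range (x + 1)).filter fun n : ℕ =>
        1 < q.eval (n : ℤ) ∧ ArithmeticFunction.cardFactors ((q.eval (n : ℤ)).toNat) ≤ 2).card := by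
  refine congrArg Finset.card (Finset.filter_congr fun n _ => ?_)
  simp

/-- The Bateman–Horn main term of a one-member quadratic system `![q]` is `C(q)/2 · x/log x`. -/
theorem LowerNonlinearGlue.mainTerm_single {q : ℤ[X]} (hq : q.natDegree = 2) (x : ℕ) :
    batemanHornConst ![q] / (∏ i, ((![q] i).natDegree : ℝ)) * (x : ℝ) / Real.log x ^ 1 =
      batemanHornConst ![q] / 2 * (x : ℝ) / Real.log x := by
  simp [hq]

/-- **`LowerNonlinearGlue` holds** (stmt-Parity-26568): `ChenQuad → ChenRest → ParityLift → LowerNonlinear`.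
Given a nonlinear Bateman–Horn system, `ParityLift` reduces the prime lower bound to the excess-1
almost-prime lower bound, which is `ChenQuad` on the quadratic cell (`k = 1`, degree 2, system `![q]`)
and `ChenRest` on every other nonlinear cell. -/
theorem lowerNonlinearGlue_holds : LowerNonlinearGlue := by
  intro hQ hR hP k f hf hdeg
  refine hP k f hf hdeg ?_
  by_cases hcell : k = 1 ∧ ∀ i, (f i).natDegree = 2
  · obtain ⟨rfl, hdeg2⟩ := hcell
    intro ε hε
    rw [LowerNonlinearGlue.vec_single_eq f] at hf ⊢
    filter_upwards [hQ (f 0) hf (hdeg2 0) ε hε] with x hx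
    rwa [LowerNonlinearGlue.mainTerm_single (hdeg2 0), LowerNonlinearGlue.count_single]
  · exact hR k f hf hdeg hcell

end Summit.Parity.BatemanHorn.Theses.OneSidedDegreeLadder
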